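/-
Copyright (c) 2026. All rights reserved.
Released under Apache 2.0 license as described in the file LICENSE.
-/
import Mathlib
import Summits.MatrixMultiplication.MatrixMultiplication.Theorems.SubgroupIdentityDesigns.Negative.SquareReflections
import Summits.MatrixMultiplication.MatrixMultiplication.Theorems.SubgroupIdentityDesigns.Negative.ReflectionClassAllPrimes

/-!
# Reflection classes: no member of a level-one design triple contains a full square class

Support file for the crux `LevelGradedCohnUmans.SubgroupIdentityDesigns` (the crux item stays
open; this is NEGATIVE knowledge about its level-one slice).  VALUE = THEOREM, NOT summit
progress.

For an odd prime `p` the reflections `refl b` of `𝔽_p^m` (`b ⬝ᵥ b ≠ 0`) fall into two classes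
according to whether `b ⬝ᵥ b` is a square.  The class of sign `+χ(−1)` (square class when
`p ≡ 1 (mod 4)`, non-square class when `p ≡ 3 (mod 4)`) was excluded for every `p` and every
`m ≥ 3` in `SquareReflections` / `NonsquareReflectionsFour` (fixed-vector covers); the class of
sign `−χ(−1)` is excluded for every `p ≥ 5` and every `m ≥ 3` by the all-`p` theorem of the
unified reflection-class certificate, `ReflectionClassAllPrimes`.  This file merely assembles the
four cases into one statement per member, uniform in the class `τ : Bool`
(`τ = decide (IsSquare (b ⬝ᵥ b))`):

**`no_design_mem₁/₂/₃_of_class (hp5 : 5 ≤ p) (hm : 3 ≤ m) (τ : Bool)`** — if member `i` of a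
subgroup triple of `GL_m(𝔽_p)` contains every reflection `refl b` with `b ⬝ᵥ b ≠ 0` and
`decide (IsSquare (b ⬝ᵥ b)) = τ`, the triple carries no level-one identity design (no TPP and no
dimension inequality are used).  Together with `AllReflections` (all reflections, every odd `p`)
this settles every reflection-closed candidate member at level one for `p ≥ 5`; `p = 3` is not
covered here (the certificate degenerates: its base weight vanishes), see `PThreeAllDimensions`
for the level-one slice over `𝔽_3`.

Sorry-free; standard axioms; no new definitions.
Report: `run/shared/lean/b2b/levelgraded-cu/ORACLE-g24.md` §G24-4.
-/

set_option linter.dupNamespace false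

open scoped BigOperators Matrix

namespace Summit.MatrixMultiplication.MatrixMultiplication.Theorems.SubgroupIdentityDesigns.Negative
namespace ReflectionClassComplete

open Summit.MatrixMultiplication.MatrixMultiplication.Theorems.LieRankDesigns.Negative (GLm Mat)
open NonsquareReflections (refl no_design_sq_mem₁_of_three_le no_design_sq_mem₂_of_three_le
  no_design_sq_mem₃_of_three_le no_design_mem₁_of_three_le no_design_mem₂_of_three_le
  no_design_mem₃_of_three_le)
open ReflectionClassAllPrimes (no_design_sq_mem₁ no_design_sq_mem₂ no_design_sq_mem₃
  no_design_nsq_mem₁ no_design_nsq_mem₂ no_design_nsq_mem₃)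

variable {p : ℕ} [hp : Fact p.Prime] {m : ℕ}

/-- **NO MEMBER CONTAINS A FULL SQUARE CLASS OF REFLECTIONS OF `𝔽_p^m`** (`p ≥ 5`, `m ≥ 3`,
either class `τ`, every `ε`, no TPP): member `1`. -/
theorem no_design_mem₁_of_class (hp5 : 5 ≤ p) (hm : 3 ≤ m) (τ : Bool)
    {H₁ H₂ H₃ : Subgroup (GLm p m)}
    (h₁ : ∀ b : Fin m → ZMod p, b ⬝ᵥ b ≠ 0 → decide (IsSquare (b ⬝ᵥ b)) = τ → refl b ∈ H₁) :
    ¬ ∃ f : Mat p m → ℂ, (∀ M, 1 < M.rank → f M = 0) ∧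
      (∑ M, f M * ZMod.stdAddChar (Matrix.trace (M * ((1 : GLm p m) : Mat p m)))) = 1 ∧
      ∀ a ∈ H₁, ∀ b ∈ H₂, ∀ g ∈ H₃, a * b * g ≠ 1 →
        (∑ M, f M * ZMod.stdAddChar (Matrix.trace (M * ((a * b * g : GLm p m) : Mat p m)))) = 0 :=
  by
  have hp2 : p ≠ 2 := by rintro rfl; omega
  by_cases h1 : IsSquare (-1 : ZMod p)
  · cases τ
    · exact no_design_nsq_mem₁ hp5 h1 hm fun b hb =>
        h₁ b (fun h0 => hb (h0 ▸ IsSquare.zero)) (decide_eq_false hb)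
    · exact no_design_sq_mem₁_of_three_le h1 hp2 hm fun b hb0 hb => h₁ b hb0 (decide_eq_true hb)
  · cases τ
    · exact no_design_mem₁_of_three_le h1 hm fun b hb =>
        h₁ b (fun h0 => hb (h0 ▸ IsSquare.zero)) (decide_eq_false hb)
    · exact no_design_sq_mem₁ hp5 h1 hm fun b hb0 hb => h₁ b hb0 (decide_eq_true hb)

/-- Member `2` (`p ≥ 5`, `m ≥ 3`, either class `τ`). -/
theorem no_design_mem₂_of_class (hp5 : 5 ≤ p) (hm : 3 ≤ m) (τ : Bool)
    {H₁ H₂ H₃ : Subgroup (GLm p m)}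
    (h₂ : ∀ b : Fin m → ZMod p, b ⬝ᵥ b ≠ 0 → decide (IsSquare (b ⬝ᵥ b)) = τ → refl b ∈ H₂) :
    ¬ ∃ f : Mat p m → ℂ, (∀ M, 1 < M.rank → f M = 0) ∧
      (∑ M, f M * ZMod.stdAddChar (Matrix.trace (M * ((1 : GLm p m) : Mat p m)))) = 1 ∧
      ∀ a ∈ H₁, ∀ b ∈ H₂, ∀ g ∈ H₃, a * b * g ≠ 1 →
        (∑ M, f M * ZMod.stdAddChar (Matrix.trace (M * ((a * b * g : GLm p m) : Mat p m)))) = 0 :=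
  by
  have hp2 : p ≠ 2 := by rintro rfl; omega
  by_cases h1 : IsSquare (-1 : ZMod p)
  · cases τ
    · exact no_design_nsq_mem₂ hp5 h1 hm fun b hb =>
        h₂ b (fun h0 => hb (h0 ▸ IsSquare.zero)) (decide_eq_false hb)
    · exact no_design_sq_mem₂_of_three_le h1 hp2 hm fun b hb0 hb => h₂ b hb0 (decide_eq_true hb)
  · cases τ
    · exact no_design_mem₂_of_three_le h1 hm fun b hb =>
        h₂ b (fun h0 => hb (h0 ▸ IsSquare.zero)) (decide_eq_false hb)
    · exact no_design_sq_mem₂ hp5 h1 hm fun b hb0 hb => h₂ b hb0 (decide_eq_true hb)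

/-- Member `3` (`p ≥ 5`, `m ≥ 3`, either class `τ`). -/
theorem no_design_mem₃_of_class (hp5 : 5 ≤ p) (hm : 3 ≤ m) (τ : Bool)
    {H₁ H₂ H₃ : Subgroup (GLm p m)}
    (h₃ : ∀ b : Fin m → ZMod p, b ⬝ᵥ b ≠ 0 → decide (IsSquare (b ⬝ᵥ b)) = τ → refl b ∈ H₃) :
    ¬ ∃ f : Mat p m → ℂ, (∀ M, 1 < M.rank → f M = 0) ∧
      (∑ M, f M * ZMod.stdAddChar (Matrix.trace (M * ((1 : GLm p m) : Mat p m)))) = 1 ∧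
      ∀ a ∈ H₁, ∀ b ∈ H₂, ∀ g ∈ H₃, a * b * g ≠ 1 →
        (∑ M, f M * ZMod.stdAddChar (Matrix.trace (M * ((a * b * g : GLm p m) : Mat p m)))) = 0 :=
  by
  have hp2 : p ≠ 2 := by rintro rfl; omega
  by_cases h1 : IsSquare (-1 : ZMod p)
  · cases τ
    · exact no_design_nsq_mem₃ hp5 h1 hm fun b hb =>
        h₃ b (fun h0 => hb (h0 ▸ IsSquare.zero)) (decide_eq_false hb)
    · exact no_design_sq_mem₃_of_three_le h1 hp2 hm fun b hb0 hb => h₃ b hb0 (decide_eq_true hb)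
  · cases τ
    · exact no_design_mem₃_of_three_le h1 hm fun b hb =>
        h₃ b (fun h0 => hb (h0 ▸ IsSquare.zero)) (decide_eq_false hb)
    · exact no_design_sq_mem₃ hp5 h1 hm fun b hb0 hb => h₃ b hb0 (decide_eq_true hb)

/-- **SUMMARY (`p ≥ 5`, `m ≥ 3`)**: if SOME member of a subgroup triple of `GL_m(𝔽_p)` contains
a full square class of reflections (either class), the triple carries no level-one identity
design. -/
theorem no_design_of_class (hp5 : 5 ≤ p) (hm : 3 ≤ m) (τ : Bool)
    {H₁ H₂ H₃ : Subgroup (GLm p m)}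
    (h : (∀ b : Fin m → ZMod p, b ⬝ᵥ b ≠ 0 → decide (IsSquare (b ⬝ᵥ b)) = τ → refl b ∈ H₁) ∨
      (∀ b : Fin m → ZMod p, b ⬝ᵥ b ≠ 0 → decide (IsSquare (b ⬝ᵥ b)) = τ → refl b ∈ H₂) ∨
      (∀ b : Fin m → ZMod p, b ⬝ᵥ b ≠ 0 → decide (IsSquare (b ⬝ᵥ b)) = τ → refl b ∈ H₃)) :
    ¬ ∃ f : Mat p m → ℂ, (∀ M, 1 < M.rank → f M = 0) ∧
      (∑ M, f M * ZMod.stdAddChar (Matrix.trace (M * ((1 : GLm p m) : Mat p m)))) = 1 ∧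
      ∀ a ∈ H₁, ∀ b ∈ H₂, ∀ g ∈ H₃, a * b * g ≠ 1 →
        (∑ M, f M * ZMod.stdAddChar (Matrix.trace (M * ((a * b * g : GLm p m) : Mat p m)))) = 0 :=
  by
  rcases h with h | h | h
  · exact no_design_mem₁_of_class hp5 hm τ h
  · exact no_design_mem₂_of_class hp5 hm τ h
  · exact no_design_mem₃_of_class hp5 hm τ h

end ReflectionClassComplete
end Summit.MatrixMultiplication.MatrixMultiplication.Theorems.SubgroupIdentityDesigns.Negative
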